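import Literature.Probability.Percolation.FourArmGarbanProofs
import Literature.Probability.Percolation.FourArmGarbanMonotone
import Literature.Probability.Percolation.RSWChainingInputs
import Literature.Probability.Percolation.RSW
import HarnessLib

/-!
# Gluing one-arm events through circuits: extendability and quasi-multiplicativity (bond `ℤ²`)

Topic `Literature/Probability/Percolation`; proofs only (no definition, no named fact). A
bottom-up layer towards the named fact `Kesten1987_zdKestenRelation`
(`ZdNearCriticalWindow.lean`): the separation-free case `j = 1` of Nolin's extendability and
quasi-multiplicativity of arm events (Nolin 2008, Prop. 12 and Prop. 13 for one arm [EJP: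
Props. 12–13; arXiv 0711.4948: Props. 11–12]; proof of Prop. 12 (i): "it suffices to glue
crossings with circuits in annuli, using FKG"; Kesten 1987, §2), for bond percolation on `ℤ²`
and the tree's one-arm event `sqAnnulusOpenCrossing m n` (an open path of the square annulus
`A_{m,n} = {m ≤ ‖·‖_∞ ≤ n}` from `‖·‖_∞ = m` to `‖·‖_∞ = n`, `FourArmGarban.lean`) and Grimmett's
circuit event `openCircuitAround l` (an open circuit of `A(l) = B(3l) ∖ B(l)` around the
origin, `AnnulusCircuits.lean`), at EVERY parameter `p`:

* `mem_sqAnnulusOpenCrossing_of_glue` — **deterministic gluing**: an open crossing of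
  `A_{m,3l}`, an open circuit of `A(l)` around the origin and an open crossing of `A_{l+1,n}`
  together contain an open crossing of `A_{m,n}` (`m ≤ l+1`, `3l ≤ n`; the circuit meets both
  crossings by `exists_mem_support_inter_of_enclosesOrigin`);
* `real_sqAnnulusOpenCrossing_ge_glue` — **Harris–FKG**:
  `P_p(𝒜₁(A_{m,n})) ≥ P_p(𝒜₁(A_{m,3l})) · P_p(O(l)) · P_p(𝒜₁(A_{l+1,n}))` — Nolin's
  quasi-multiplicativity for one arm, with the circuit probability left symbolic (it is bounded
  below at `p = 1/2` by `Grimmett1999_openCircuitAround_half_holds`, for `p ≥ 1/2` by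
  `exists_le_real_openCircuitAround_of_half_le` and for `p < 1/2` below `L_ε(p)` by
  `Nolin2008_zdCircuit_below_charLength`);
* `lrCrossingAt_subset_sqAnnulusOpenCrossing`, `crossingProb_le_real_sqAnnulusOpenCrossing` —
  a long-way open crossing of the rectangle `[a, b] × [-a, a]` crosses `A_{a,b}`, so
  `P_p(𝒜₁(A_{a,b})) ≥ crossingProb p (b - a) (2a)` (RSW input);
* `real_sqAnnulusOpenCrossing_extend` — **extendability**:
  `P_p(𝒜₁(A_{m,4(l+1)})) ≥ P_p(𝒜₁(A_{m,3l})) · P_p(O(l)) · crossingProb p (3(l+1)) (2(l+1))`.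
-/

noncomputable section

open MeasureTheory Set
open scoped unitInterval

namespace Literature.Probability.Percolation

open LatticeModels

/-! ### Deterministic gluing -/

/-- `sqAnnulusOpenCrossing m n` is the open crossing event of the finite region
`annulus 2 (m-1) n` between the two spheres. [folklore] -/
theorem sqAnnulusOpenCrossing_eq_openCrossing (m n : ℕ) :
    sqAnnulusOpenCrossing m n =
      openCrossing (↑(annulus 2 (m - 1) n) : Set (Site 2)) ↑(siteSphere m) ↑(siteSphere n) := by
  ext ω
  simp only [sqAnnulusOpenCrossing, mem_openCrossing_iff, Finset.mem_coe, sqAnnulus, mem_setOf_eq]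

/-- The one-arm event is increasing. [folklore] -/
theorem isUpperSet_sqAnnulusOpenCrossing (m n : ℕ) : IsUpperSet (sqAnnulusOpenCrossing m n) := by
  rw [sqAnnulusOpenCrossing_eq_openCrossing]; exact isUpperSet_openCrossing _ _ _

/-- The one-arm event is measurable. [folklore] -/
theorem measurableSet_sqAnnulusOpenCrossing (m n : ℕ) : MeasurableSet (sqAnnulusOpenCrossing m n) := by
  rw [sqAnnulusOpenCrossing_eq_openCrossing]; exact measurableSet_openCrossing _ _ _

/-- Grimmett's annulus `A(l) = B(3l) ∖ B(l)` lies in `A_{m,n}` for `m ≤ l + 1` and `3l ≤ n`.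
[folklore] -/
theorem annulus_subset_sqAnnulus {m l n : ℕ} (hml : m ≤ l + 1) (hln : 3 * l ≤ n) {z : Site 2}
    (hz : z ∈ annulus 2 l (3 * l)) : z ∈ sqAnnulus m n := by
  rw [mem_annulus] at hz
  simp only [sqAnnulus, Finset.mem_coe, mem_annulus]
  exact ⟨box_mono 2 hln hz.1, fun h => hz.2 (box_mono 2 (by omega) h)⟩

/-- **Deterministic gluing of one-arm events through a circuit** (Nolin 2008, proof of Prop. 12
(i): "glue crossings with circuits in annuli"; Kesten 1987, §2): on a lattice configuration, an
open crossing of `A_{m,3l}`, an open circuit of `A(l) = B(3l) ∖ B(l)` around the origin and an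
open crossing of `A_{l+1,n}` (`1 ≤ m ≤ l+1`, `3l ≤ n`) contain an open crossing of `A_{m,n}`: the
circuit meets the first crossing (both live in `A_{m,3l}`) and the second one (both live in
`A_{l+1,n}`), by `exists_mem_support_inter_of_enclosesOrigin`. [cite: Nolin2008, §4.3, proof of Prop. 12 (arXiv 0711.4948: Prop. 11)] -/
theorem mem_sqAnnulusOpenCrossing_of_glue {m l n : ℕ} (hm : 1 ≤ m) (hml : m ≤ l + 1)
    (hln : 3 * l ≤ n) {ω : BondConfig (Site 2)} (hω : ω ⊆ (zdGraph 2).edgeSet)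
    (h1 : ω ∈ sqAnnulusOpenCrossing m (3 * l)) (hc : ω ∈ openCircuitAround l)
    (h2 : ω ∈ sqAnnulusOpenCrossing (l + 1) n) : ω ∈ sqAnnulusOpenCrossing m n := by
  classical
  obtain ⟨x₁, hx₁, y₁, hy₁, hP₁⟩ := h1
  obtain ⟨P₁, hP₁s, hP₁e⟩ := exists_walk_of_mem_openConnIn hω hP₁
  obtain ⟨u, C, -, hCs, hCe, hCenc⟩ := hc
  obtain ⟨x₂, hx₂, y₂, hy₂, hP₂⟩ := h2
  obtain ⟨P₂, hP₂s, hP₂e⟩ := exists_walk_of_mem_openConnIn hω hP₂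
  -- the circuit inside the two frames and inside `A_{m,n}`
  have hC₁ : ∀ z ∈ C.support, z ∈ sqAnnulus m (3 * l) := fun z hz =>
    annulus_subset_sqAnnulus hml le_rfl (hCs z hz)
  have hC₂ : ∀ z ∈ C.support, z ∈ sqAnnulus (l + 1) n := fun z hz =>
    annulus_subset_sqAnnulus le_rfl hln (hCs z hz)
  have hC : ∀ z ∈ C.support, z ∈ sqAnnulus m n := fun z hz =>
    annulus_subset_sqAnnulus hml hln (hCs z hz)
  have hA₁ : sqAnnulus m (3 * l) ⊆ sqAnnulus m n := sqAnnulus_mono le_rfl hln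
  have hA₂ : sqAnnulus (l + 1) n ⊆ sqAnnulus m n := sqAnnulus_mono hml le_rfl
  -- the circuit meets both crossings
  obtain ⟨z₁, hz₁P, hz₁C⟩ := exists_mem_support_inter_of_enclosesOrigin hm hC₁ hCenc hx₁ hy₁ P₁ hP₁s
  obtain ⟨z₂, hz₂P, hz₂C⟩ :=
    exists_mem_support_inter_of_enclosesOrigin (by omega) hC₂ hCenc hx₂ hy₂ P₂ hP₂s
  -- glue: `x₁ ↔ z₁` (along `P₁`), `z₁ ↔ z₂` (along `C`), `z₂ ↔ y₂` (along `P₂`)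
  have g₁ : ω ∈ openConnIn (sqAnnulus m n) x₁ z₁ :=
    mem_openConnIn_of_mem_support P₁ (fun z hz => hA₁ (hP₁s z hz)) hP₁e hz₁P
  have g₂ : ω ∈ openConnIn (sqAnnulus m n) z₁ z₂ := by
    have a := mem_openConnIn_of_mem_support C hC hCe hz₁C
    have b := mem_openConnIn_of_mem_support C hC hCe hz₂C
    rw [openConnIn_comm] at a
    exact PlanarDuality.openConnIn_trans a b
  have g₃ : ω ∈ openConnIn (sqAnnulus m n) z₂ y₂ := by
    have c := mem_openConnIn_of_mem_support P₂.reverse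
      (fun z hz => hA₂ (hP₂s z (by simpa using hz)))
      (fun e he => hP₂e e (by simpa using he)) (by simpa using hz₂P)
    rwa [openConnIn_comm] at c
  exact ⟨x₁, hx₁, y₂, hy₂, PlanarDuality.openConnIn_trans (PlanarDuality.openConnIn_trans g₁ g₂) g₃⟩

/-! ### Harris–FKG: quasi-multiplicativity for one arm -/

/-- **Quasi-multiplicativity for one arm, with the circuit probability symbolic** (Nolin 2008,
Prop. 13 (`j = 1`) via the proof of Prop. 12 (i) [arXiv: Props. 11–12]; Kesten 1987, §2): for
every `p`, `1 ≤ m ≤ l+1` and `3l ≤ n`,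
`P_p(𝒜₁(A_{m,3l})) · P_p(O(l)) · P_p(𝒜₁(A_{l+1,n})) ≤ P_p(𝒜₁(A_{m,n}))` — the three events are
increasing and measurable, so Harris–FKG (`harris_fkg_holds`, twice) bounds the probability of
their intersection from below, and on it (a.s. a lattice configuration) the glued crossing
exists (`mem_sqAnnulusOpenCrossing_of_glue`). [cite: Nolin2008, §4.3, Prop. 12–13 (arXiv 0711.4948: Prop. 11–12)] -/
theorem real_sqAnnulusOpenCrossing_ge_glue (p : unitInterval) {m l n : ℕ} (hm : 1 ≤ m)
    (hml : m ≤ l + 1) (hln : 3 * l ≤ n) :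
    (bondPercolation (zdGraph 2) p).real (sqAnnulusOpenCrossing m (3 * l)) *
        (bondPercolation (zdGraph 2) p).real (openCircuitAround l) *
        (bondPercolation (zdGraph 2) p).real (sqAnnulusOpenCrossing (l + 1) n) ≤
      (bondPercolation (zdGraph 2) p).real (sqAnnulusOpenCrossing m n) := by
  set μ := bondPercolation (zdGraph 2) p with hμ
  have hU₁ := isUpperSet_sqAnnulusOpenCrossing m (3 * l)
  have hM₁ := measurableSet_sqAnnulusOpenCrossing m (3 * l)
  have hU₂ := isUpperSet_openCircuitAround l
  have hM₂ := measurableSet_openCircuitAround l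
  have hU₃ := isUpperSet_sqAnnulusOpenCrossing (l + 1) n
  have hM₃ := measurableSet_sqAnnulusOpenCrossing (l + 1) n
  have h12 : μ.real (sqAnnulusOpenCrossing m (3 * l)) * μ.real (openCircuitAround l) ≤
      μ.real (sqAnnulusOpenCrossing m (3 * l) ∩ openCircuitAround l) :=
    harris_fkg_holds (zdGraph 2) p hU₁ hU₂ hM₁ hM₂
  have h123 : μ.real (sqAnnulusOpenCrossing m (3 * l) ∩ openCircuitAround l) *
      μ.real (sqAnnulusOpenCrossing (l + 1) n) ≤
      μ.real (sqAnnulusOpenCrossing m (3 * l) ∩ openCircuitAround l ∩ sqAnnulusOpenCrossing (l + 1) n) :=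
    harris_fkg_holds (zdGraph 2) p (hU₁.inter hU₂) hU₃ (hM₁.inter hM₂) hM₃
  have hsub : μ.real (sqAnnulusOpenCrossing m (3 * l) ∩ openCircuitAround l ∩
      sqAnnulusOpenCrossing (l + 1) n) ≤ μ.real (sqAnnulusOpenCrossing m n) := by
    refine ENNReal.toReal_mono (measure_ne_top _ _) (measure_mono_ae ?_)
    filter_upwards [ae_subset_edgeSet (zdGraph 2) p] with ω hω h
    exact mem_sqAnnulusOpenCrossing_of_glue hm hml hln hω h.1.1 h.1.2 h.2
  calc μ.real (sqAnnulusOpenCrossing m (3 * l)) * μ.real (openCircuitAround l) *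
        μ.real (sqAnnulusOpenCrossing (l + 1) n)
      ≤ μ.real (sqAnnulusOpenCrossing m (3 * l) ∩ openCircuitAround l) *
          μ.real (sqAnnulusOpenCrossing (l + 1) n) :=
        mul_le_mul_of_nonneg_right h12 measureReal_nonneg
    _ ≤ _ := h123
    _ ≤ _ := hsub

/-! ### RSW input: a rectangle crossing crosses the annulus -/

/-- **A long-way open crossing of the rectangle `[a, b] × [-a, a]` is an open crossing of
`A_{a,b}`** (`1 ≤ a ≤ b`): the rectangle lies in `A_{a,b}` (the sup-norm of its points is the
first coordinate), its left side on the sphere `‖·‖_∞ = a`, its right side on `‖·‖_∞ = b`.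
[folklore] -/
theorem lrCrossingAt_subset_sqAnnulusOpenCrossing {a b : ℕ} (ha : 1 ≤ a) (hab : a ≤ b) :
    lrCrossingAt ![(a : ℤ), -(a : ℤ)] (b - a) (2 * a) ⊆ sqAnnulusOpenCrossing a b := by
  rw [sqAnnulusOpenCrossing_eq_openCrossing]
  have hba : ((b - a : ℕ) : ℤ) = b - a := by omega
  refine openCrossing_mono ?_ ?_ ?_
  · intro z hz
    rw [mem_image_rectangle_iff] at hz
    simp only [Matrix.cons_val_zero, Matrix.cons_val_one] at hz
    rw [Finset.mem_coe, mem_annulus, mem_box, mem_box, Fin.forall_fin_two, Fin.forall_fin_two]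
    omega
  · rintro z ⟨w, hw, rfl⟩
    rw [Finset.mem_coe, leftSide, Finset.mem_filter, mem_rectangle_iff] at hw
    rw [Finset.mem_coe, siteSphere, Finset.mem_sdiff, mem_box, mem_box, Fin.forall_fin_two,
      Fin.forall_fin_two]
    simp only [Pi.add_apply, Matrix.cons_val_zero, Matrix.cons_val_one]
    omega
  · rintro z ⟨w, hw, rfl⟩
    rw [Finset.mem_coe, rightSide, Finset.mem_filter, mem_rectangle_iff] at hw
    rw [Finset.mem_coe, siteSphere, Finset.mem_sdiff, mem_box, mem_box, Fin.forall_fin_two,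
      Fin.forall_fin_two]
    simp only [Pi.add_apply, Matrix.cons_val_zero, Matrix.cons_val_one]
    omega

/-- **RSW input for one-arm events**: `crossingProb p (b - a) (2a) ≤ P_p(𝒜₁(A_{a,b}))` for
`1 ≤ a ≤ b` (translation invariance, `bondPercolation_real_lrCrossingAt`). [folklore] -/
theorem crossingProb_le_real_sqAnnulusOpenCrossing (p : unitInterval) {a b : ℕ} (ha : 1 ≤ a)
    (hab : a ≤ b) :
    crossingProb p (b - a) (2 * a) ≤ (bondPercolation (zdGraph 2) p).real (sqAnnulusOpenCrossing a b) := by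
  rw [← bondPercolation_real_lrCrossingAt p ![(a : ℤ), -(a : ℤ)] (b - a) (2 * a)]
  exact measureReal_mono (lrCrossingAt_subset_sqAnnulusOpenCrossing ha hab)

/-- **Extendability of one arm (outwards)** (Nolin 2008, Prop. 12 (i) [arXiv: Prop. 11], `j = 1`;
Kesten 1987, §2): for every `p` and `1 ≤ m ≤ l + 1`,
`P_p(𝒜₁(A_{m,3l})) · P_p(O(l)) · crossingProb p (3(l+1)) (2(l+1)) ≤ P_p(𝒜₁(A_{m,4(l+1)}))` —
the crossing of `A_{m,3l}` is glued, through a circuit of `A(l)`, to a long-way crossing of the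
rectangle `[l+1, 4(l+1)] × [-(l+1), l+1]`, which crosses `A_{l+1,4(l+1)}`. The two factors
besides `P_p(𝒜₁(A_{m,3l}))` are bounded below by RSW constants below `L_ε(p)` (`ZdGeneralRSW.lean`,
`ZdNearCriticalWindowProofs.lean`, `ZdAnnulusCircuitsGeneral.lean`). [cite: Nolin2008, §4.3, Prop. 12 (i) (arXiv 0711.4948: Prop. 11)] -/
theorem real_sqAnnulusOpenCrossing_extend (p : unitInterval) {m l : ℕ} (hm : 1 ≤ m) (hml : m ≤ l + 1) :
    (bondPercolation (zdGraph 2) p).real (sqAnnulusOpenCrossing m (3 * l)) *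
        (bondPercolation (zdGraph 2) p).real (openCircuitAround l) *
        crossingProb p (3 * (l + 1)) (2 * (l + 1)) ≤
      (bondPercolation (zdGraph 2) p).real (sqAnnulusOpenCrossing m (4 * (l + 1))) := by
  have h1 := real_sqAnnulusOpenCrossing_ge_glue p hm hml (n := 4 * (l + 1)) (by omega)
  have h2 : crossingProb p (3 * (l + 1)) (2 * (l + 1)) ≤
      (bondPercolation (zdGraph 2) p).real (sqAnnulusOpenCrossing (l + 1) (4 * (l + 1))) := by
    have := crossingProb_le_real_sqAnnulusOpenCrossing p (a := l + 1) (b := 4 * (l + 1))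
      (by omega) (by omega)
    rwa [show 4 * (l + 1) - (l + 1) = 3 * (l + 1) by omega] at this
  refine le_trans ?_ h1
  exact mul_le_mul_of_nonneg_left h2 (mul_nonneg measureReal_nonneg measureReal_nonneg)

end Literature.Probability.Percolation
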